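import Summits.SmoothPoincare4.SmoothPoincare4.Theorems.SymplecticOrigamiGromovRecognitionRelEndStubFlatLeavesAux4
import Summits.SmoothPoincare4.SmoothPoincare4.Theorems.SymplecticOrigamiGromovRecognitionRelEndStubFlatLeavesAux5
import Mathlib.Geometry.Manifold.LocalDiffeomorph
import Mathlib.Geometry.Manifold.MFDeriv.Basic
import Mathlib.Analysis.InnerProductSpace.PiL2
import Mathlib.Analysis.Complex.Basic

/-!
# The two spheres at infinity of the wedge cap are embedded
(registered helpers `helper_wedgeSphereEmbV` and `helper_wedgeSphereEmbH` of line
`cross-cap-laurent`, crux `GromovRecognitionRelEnd`, item stmt-SmoothPoincare4-11009)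

In the wedge cap `X` the cap charts `ηV` (polydisc `D_V = {p 0² + p 1² < R₁⁻²}`), `ηH`
(`D_H = {p 2² + p 3² < R₁⁻²}`) and `ηC` (`D_C = D_V ∩ D_H`-shaped bidisc) are injective local
diffeomorphisms on their domains, glued by complex inversion of one factor
(`ηC (u, t) = ηV (u, 1/t)` for `t ≠ 0`, resp. `ηC (u, t) = ηH (1/u, t)` for `u ≠ 0`).  The sphere
at infinity `V∞` (resp. `H∞`) is given in two-chart form `u z = ηV (0, 0, z)` (resp.
`u z = ηH (z, 0, 0)`), `v w = u w⁻¹` for `w ≠ 0`, `v 0 = ηC 0`.  This file proves that this sphere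
is EMBEDDED in the sense used by the crux:

* `u` is injective: `u = ηV ∘ s` with the injective affine slice `s z = (0, 0, z)` taking values
  in `D_V` (as `0 < R₁⁻²`), and `ηV` is injective on `D_V`;
* `du_z` is injective: chain rule along the slice (`FlatLeaves.mfderiv_comp_slice_apply`),
  `ds = S` is an injective real-linear map and `d(ηV)_{s z}` is bijective because `ηV` is a local
  diffeomorphism at `s z ∈ D_V` (`IsLocalDiffeomorphAt.mfderivToContinuousLinearEquiv`);
* `dv_0` is injective: near `w = 0` the gluing clause gives `v w = ηC (s w)` (the inversion acts
  on the slice as `t ↦ 1/t`, `FlatLeaves.inv2_sliceV` / `FlatLeaves.inv1_sliceH`), so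
  `mfderiv v 0 = mfderiv (ηC ∘ s) 0` (`Filter.EventuallyEq.mfderiv_eq`), injective as before since
  `ηC` is a local diffeomorphism at `s 0 = 0 ∈ D_C`;
* `v 0 = ηC 0 ∉ range u` by the axis clause `ηV (0, 0, ·, ·) ≠ ηC 0`.

Everything is proved; no definition, no named fact.

References: M. Gromov, *Pseudo holomorphic curves in symplectic manifolds*, Invent. Math. 82
(1985), 2.4.A₁′ [Gromov1985]; D. McDuff, D. Salamon, *J-holomorphic Curves and Symplectic
Topology*, 2nd ed. (2012), §4.2 [McDuffSalamon2012].
-/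

noncomputable section

-- the registered namespace `Summit.SmoothPoincare4.SmoothPoincare4.Theorems…` repeats a component
set_option linter.dupNamespace false

open scoped Manifold ContDiff Topology
open Set Function Filter

namespace Summit.SmoothPoincare4.SmoothPoincare4.Theorems.GromovRecognitionRelEnd.CrossCapLaurent

namespace WedgeSphereEmb

open CapModel FlatLeaves

/-! ## Injectivity of the differential of a slice of a local diffeomorphism -/

section Slice

variable {E' : Type*} [NormedAddCommGroup E'] [NormedSpace ℝ E'] {H' : Type*}
  [TopologicalSpace H'] {I' : ModelWithCorners ℝ E' H'} {X : Type*} [TopologicalSpace X]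
  [ChartedSpace H' X] {η : EuclideanSpace ℝ (Fin 4) → X} {s : ℂ → EuclideanSpace ℝ (Fin 4)}
  {S : ℂ →L[ℝ] EuclideanSpace ℝ (Fin 4)}

/-- **The differential of a local diffeomorphism at a point is injective.** [folklore] -/
theorem mfderiv_injective_of_isLocalDiffeomorphAt {p : EuclideanSpace ℝ (Fin 4)}
    (hη : IsLocalDiffeomorphAt 𝓘(ℝ, EuclideanSpace ℝ (Fin 4)) I' ∞ η p) :
    Injective (mfderiv 𝓘(ℝ, EuclideanSpace ℝ (Fin 4)) I' η p) := by
  have h := (hη.mfderivToContinuousLinearEquiv (by simp)).injective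
  rwa [← ContinuousLinearEquiv.coe_coe,
    IsLocalDiffeomorphAt.mfderivToContinuousLinearEquiv_coe] at h

/-- **A slice of a local diffeomorphism along an injective affine map is an immersion**: if
`ds_z = S` is injective and `η` is a local diffeomorphism at `s z`, then `d(η ∘ s)_z = dη ∘ S` is
injective. [folklore] -/
theorem mfderiv_comp_slice_injective {z : ℂ} (hs : HasFDerivAt s S z) (hS : Injective S)
    (hη : IsLocalDiffeomorphAt 𝓘(ℝ, EuclideanSpace ℝ (Fin 4)) I' ∞ η (s z)) :
    Injective (mfderiv 𝓘(ℝ, ℂ) I' (fun t => η (s t)) z) := by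
  have hd : MDifferentiableAt 𝓘(ℝ, EuclideanSpace ℝ (Fin 4)) I' η (s z) :=
    hη.mdifferentiableAt (by simp)
  have hinj := mfderiv_injective_of_isLocalDiffeomorphAt hη
  intro ζ ξ h
  have h' : mfderiv 𝓘(ℝ, EuclideanSpace ℝ (Fin 4)) I' η (s z) (S ζ) =
      mfderiv 𝓘(ℝ, EuclideanSpace ℝ (Fin 4)) I' η (s z) (S ξ) := by
    rw [← mfderiv_comp_slice_apply hs hd, ← mfderiv_comp_slice_apply hs hd]
    exact h
  exact hS (hinj h')

end Slice

/-- The slice inclusion `ζ ↦ (0, 0, ζ)` is injective. [folklore] -/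
theorem slice23_injective {S : ℂ →L[ℝ] EuclideanSpace ℝ (Fin 4)}
    (hS : ∀ ζ : ℂ, S ζ = WithLp.toLp 2 ![0, 0, ζ.re, ζ.im]) : Injective S := by
  intro ζ ξ h
  have h2 := congrArg (fun q : EuclideanSpace ℝ (Fin 4) => q 2) h
  have h3 := congrArg (fun q : EuclideanSpace ℝ (Fin 4) => q 3) h
  simp only [hS] at h2 h3
  apply Complex.ext
  · simpa using h2
  · simpa using h3

/-- The slice inclusion `ζ ↦ (ζ, 0, 0)` is injective. [folklore] -/
theorem slice01_injective {S : ℂ →L[ℝ] EuclideanSpace ℝ (Fin 4)}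
    (hS : ∀ ζ : ℂ, S ζ = WithLp.toLp 2 ![ζ.re, ζ.im, 0, 0]) : Injective S := by
  intro ζ ξ h
  have h0 := congrArg (fun q : EuclideanSpace ℝ (Fin 4) => q 0) h
  have h1 := congrArg (fun q : EuclideanSpace ℝ (Fin 4) => q 1) h
  simp only [hS] at h0 h1
  apply Complex.ext
  · simpa using h0
  · simpa using h1

end WedgeSphereEmb

open CapModel FlatLeaves WedgeSphereEmb in
/-- **Registered helper `helper_wedgeSphereEmbV`** (line `cross-cap-laurent`, signature verbatim):
the vertical sphere at infinity `V∞` of the wedge cap, in two-chart form `u z = ηV (0, 0, z)`,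
`v w = u w⁻¹` (`w ≠ 0`), `v 0 = ηC 0`, is embedded: `u` is injective, every `du_z` and `dv_0` are
injective, and `v 0 ∉ range u`.  See the file header for the proof. [cite: Gromov1985, 2.4.A₁′] -/
theorem helper_wedgeSphereEmbV : ∀ (X : Type) [TopologicalSpace X] [ChartedSpace (EuclideanSpace ℝ (Fin 4)) X] [IsManifold (𝓡 4) ∞ X] (R₁ : ℝ) (ηV ηC : EuclideanSpace ℝ (Fin 4) → X) (u v : ℂ → X), 0 < R₁ → IsLocalDiffeomorphOn 𝓘(ℝ, EuclideanSpace ℝ (Fin 4)) (𝓡 4) ∞ ηV {p : EuclideanSpace ℝ (Fin 4) | p 0 ^ 2 + p 1 ^ 2 < R₁⁻¹ ^ 2} → Set.InjOn ηV {p : EuclideanSpace ℝ (Fin 4) | p 0 ^ 2 + p 1 ^ 2 < R₁⁻¹ ^ 2} → IsLocalDiffeomorphOn 𝓘(ℝ, EuclideanSpace ℝ (Fin 4)) (𝓡 4) ∞ ηC {p : EuclideanSpace ℝ (Fin 4) | p 0 ^ 2 + p 1 ^ 2 < R₁⁻¹ ^ 2 ∧ p 2 ^ 2 + p 3 ^ 2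 < R₁⁻¹ ^ 2} → (∀ p : EuclideanSpace ℝ (Fin 4), p 0 ^ 2 + p 1 ^ 2 < R₁⁻¹ ^ 2 → p 2 ^ 2 + p 3 ^ 2 < R₁⁻¹ ^ 2 → (p 2 ≠ 0 ∨ p 3 ≠ 0) → ηC p = ηV (WithLp.toLp 2 ![p 0, p 1, p 2 / (p 2 ^ 2 + p 3 ^ 2), -(p 3) / (p 2 ^ 2 + p 3 ^ 2)])) → (∀ q : EuclideanSpace ℝ (Fin 4), q 0 = 0 → q 1 = 0 → ηV q ≠ ηC 0) → ContMDiff 𝓘(ℝ, ℂ) (𝓡 4) ∞ v → (∀ z : ℂ, u z = ηV (WithLp.toLp 2 ![0, 0, z.re, z.im])) → v 0 = ηC 0 → (∀ w : ℂ, w ≠ 0 → v w = u w⁻¹) → Injective u ∧ (∀ z, Injective (mfderiv 𝓘(ℝ, ℂ) (𝓡 4) u z)) ∧ Injective (mfderiv 𝓘(ℝ, ℂ) (𝓡 4) v 0) ∧ v 0 ∉ Set.range u := by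
  intro X _ _ _ R₁ ηV ηC u v hR₁ hVloc hVinj hCloc hCV hVax _ hu hv0 huv
  classical
  -- the slice inclusion `ζ ↦ (0, 0, ζ)` as a real-linear map
  obtain ⟨T, hT, -⟩ := exists_clm_slice23
  have hT_inj : Injective T := slice23_injective hT
  -- the two coordinate domains
  set DV : Set (EuclideanSpace ℝ (Fin 4)) :=
    {p : EuclideanSpace ℝ (Fin 4) | p 0 ^ 2 + p 1 ^ 2 < R₁⁻¹ ^ 2} with hDV
  set DC : Set (EuclideanSpace ℝ (Fin 4)) :=
    {p : EuclideanSpace ℝ (Fin 4) | p 0 ^ 2 + p 1 ^ 2 < R₁⁻¹ ^ 2 ∧ p 2 ^ 2 + p 3 ^ 2 < R₁⁻¹ ^ 2}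
    with hDC
  have hR : (0 : ℝ) < R₁⁻¹ ^ 2 := by positivity
  -- the slice `s t = (0, 0, t)` and its coordinates
  set s : ℂ → EuclideanSpace ℝ (Fin 4) := fun t => WithLp.toLp 2 ![0, 0, t.re, t.im] with hs
  have hs_fd : ∀ t, HasFDerivAt s T t := hasFDerivAt_slice23 hT 0 0
  have hs0 : ∀ t, s t 0 = 0 := fun t => by simp [hs]
  have hs1 : ∀ t, s t 1 = 0 := fun t => by simp [hs]
  have hs2 : ∀ t, s t 2 = t.re := fun t => by simp [hs]
  have hs3 : ∀ t, s t 3 = t.im := fun t => by simp [hs]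
  have hs_inj : Injective s := fun t t' h => by
    apply Complex.ext
    · rw [← hs2, ← hs2, h]
    · rw [← hs3, ← hs3, h]
  have hsDV : ∀ t, s t ∈ DV := fun t => by
    show s t 0 ^ 2 + s t 1 ^ 2 < R₁⁻¹ ^ 2
    rw [hs0, hs1]; simpa using hR
  have hsDC : ∀ t : ℂ, Complex.normSq t < R₁⁻¹ ^ 2 → s t ∈ DC := fun t ht =>
    ⟨hsDV t, by show r2 (s t) < R₁⁻¹ ^ 2; rw [hs, r2_sliceV]; exact ht⟩
  have hs00 : s 0 = 0 := by
    ext i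
    fin_cases i <;> simp [hs]
  have h0C : s 0 ∈ DC := hsDC 0 (by simpa using hR)
  have hinv2s : ∀ t, inv2 (s t) = s t⁻¹ := fun t => inv2_sliceV _ _ t
  -- `u = ηV ∘ s`
  have hu' : u = fun t => ηV (s t) := funext hu
  subst hu'
  -- (1) `u` is injective
  have h1 : Injective (fun t => ηV (s t)) := fun t t' h =>
    hs_inj (hVinj (hsDV t) (hsDV t') h)
  -- (2) `du_z` is injective
  have h2 : ∀ z, Injective (mfderiv 𝓘(ℝ, ℂ) (𝓡 4) (fun t => ηV (s t)) z) := fun z =>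
    mfderiv_comp_slice_injective (hs_fd z) hT_inj (hVloc ⟨s z, hsDV z⟩)
  -- (3) `dv_0` is injective: near `0`, `v = ηC ∘ s` by the gluing clause
  have hCt : ∀ t : ℂ, Complex.normSq t < R₁⁻¹ ^ 2 → t ≠ 0 → ηC (s t) = ηV (s t⁻¹) := by
    intro t ht ht0
    have h23 : s t 2 ≠ 0 ∨ s t 3 ≠ 0 := by
      rw [hs2, hs3]
      by_contra hc
      simp only [not_or, not_not] at hc
      exact ht0 (Complex.ext hc.1 hc.2)
    rw [hCV (s t) (hsDC t ht).1 (hsDC t ht).2 h23]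
    show ηV (inv2 (s t)) = ηV (s t⁻¹)
    rw [hinv2s]
  have hvE : v =ᶠ[𝓝 0] fun t => ηC (s t) := by
    filter_upwards [eventually_normSq_lt hR] with t ht
    by_cases ht0 : t = 0
    · subst ht0
      rw [hs00]
      exact hv0
    · rw [huv t ht0, hCt t ht ht0]
  have h3 : Injective (mfderiv 𝓘(ℝ, ℂ) (𝓡 4) v 0) := by
    rw [hvE.mfderiv_eq]
    exact mfderiv_comp_slice_injective (hs_fd 0) hT_inj (hCloc ⟨s 0, h0C⟩)
  -- (4) `v 0 = ηC 0 ∉ range u` by the axis clause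
  have h4 : v 0 ∉ Set.range (fun t => ηV (s t)) := by
    rintro ⟨z, hz⟩
    exact hVax (s z) (hs0 z) (hs1 z) (hz.trans hv0)
  exact ⟨h1, h2, h3, h4⟩

open CapModel FlatLeaves WedgeSphereEmb in
/-- **Registered helper `helper_wedgeSphereEmbH`** (line `cross-cap-laurent`, signature verbatim):
the horizontal sphere at infinity `H∞` of the wedge cap, in two-chart form `u z = ηH (z, 0, 0)`,
`v w = u w⁻¹` (`w ≠ 0`), `v 0 = ηC 0`, is embedded: `u` is injective, every `du_z` and `dv_0` are
injective, and `v 0 ∉ range u`.  See the file header for the proof. [cite: Gromov1985, 2.4.A₁′] -/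
theorem helper_wedgeSphereEmbH : ∀ (X : Type) [TopologicalSpace X] [ChartedSpace (EuclideanSpace ℝ (Fin 4)) X] [IsManifold (𝓡 4) ∞ X] (R₁ : ℝ) (ηH ηC : EuclideanSpace ℝ (Fin 4) → X) (u v : ℂ → X), 0 < R₁ → IsLocalDiffeomorphOn 𝓘(ℝ, EuclideanSpace ℝ (Fin 4)) (𝓡 4) ∞ ηH {p : EuclideanSpace ℝ (Fin 4) | p 2 ^ 2 + p 3 ^ 2 < R₁⁻¹ ^ 2} → Set.InjOn ηH {p : EuclideanSpace ℝ (Fin 4) | p 2 ^ 2 + p 3 ^ 2 < R₁⁻¹ ^ 2} → IsLocalDiffeomorphOn 𝓘(ℝ, EuclideanSpace ℝ (Fin 4)) (𝓡 4) ∞ ηC {p : EuclideanSpace ℝ (Fin 4) | p 0 ^ 2 + p 1 ^ 2 < R₁⁻¹ ^ 2 ∧ p 2 ^ 2 + p 3 ^ 2 < R₁⁻¹ ^ 2} → (∀ p : EuclideanSpace ℝ (Fin 4), p 0 ^ 2 + p 1 ^ 2 < R₁⁻¹ ^ 2 → p 2 ^ 2 + p 3 ^ 2 < R₁⁻¹ ^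 2 → (p 0 ≠ 0 ∨ p 1 ≠ 0) → ηC p = ηH (WithLp.toLp 2 ![p 0 / (p 0 ^ 2 + p 1 ^ 2), -(p 1) / (p 0 ^ 2 + p 1 ^ 2), p 2, p 3])) → (∀ p : EuclideanSpace ℝ (Fin 4), p 2 = 0 → p 3 = 0 → ηH p ≠ ηC 0) → ContMDiff 𝓘(ℝ, ℂ) (𝓡 4) ∞ v → (∀ z : ℂ, u z = ηH (WithLp.toLp 2 ![z.re, z.im, 0, 0])) → v 0 = ηC 0 → (∀ w : ℂ, w ≠ 0 → v w = u w⁻¹) → Injective u ∧ (∀ z, Injective (mfderiv 𝓘(ℝ, ℂ) (𝓡 4) u z)) ∧ Injective (mfderiv 𝓘(ℝ, ℂ) (𝓡 4) v 0) ∧ v 0 ∉ Set.range u := by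
  intro X _ _ _ R₁ ηH ηC u v hR₁ hHloc hHinj hCloc hCH hHax _ hu hv0 huv
  classical
  -- the slice inclusion `ζ ↦ (ζ, 0, 0)` as a real-linear map
  obtain ⟨T, hT, -⟩ := exists_clm_slice01
  have hT_inj : Injective T := slice01_injective hT
  -- the two coordinate domains
  set DH : Set (EuclideanSpace ℝ (Fin 4)) :=
    {p : EuclideanSpace ℝ (Fin 4) | p 2 ^ 2 + p 3 ^ 2 < R₁⁻¹ ^ 2} with hDH
  set DC : Set (EuclideanSpace ℝ (Fin 4)) :=
    {p : EuclideanSpace ℝ (Fin 4) | p 0 ^ 2 + p 1 ^ 2 < R₁⁻¹ ^ 2 ∧ p 2 ^ 2 + p 3 ^ 2 < R₁⁻¹ ^ 2}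
    with hDC
  have hR : (0 : ℝ) < R₁⁻¹ ^ 2 := by positivity
  -- the slice `s t = (t, 0, 0)` and its coordinates
  set s : ℂ → EuclideanSpace ℝ (Fin 4) := fun t => WithLp.toLp 2 ![t.re, t.im, 0, 0] with hs
  have hs_fd : ∀ t, HasFDerivAt s T t := hasFDerivAt_slice01 hT 0 0
  have hs0 : ∀ t, s t 0 = t.re := fun t => by simp [hs]
  have hs1 : ∀ t, s t 1 = t.im := fun t => by simp [hs]
  have hs2 : ∀ t, s t 2 = 0 := fun t => by simp [hs]
  have hs3 : ∀ t, s t 3 = 0 := fun t => by simp [hs]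
  have hs_inj : Injective s := fun t t' h => by
    apply Complex.ext
    · rw [← hs0, ← hs0, h]
    · rw [← hs1, ← hs1, h]
  have hsDH : ∀ t, s t ∈ DH := fun t => by
    show s t 2 ^ 2 + s t 3 ^ 2 < R₁⁻¹ ^ 2
    rw [hs2, hs3]; simpa using hR
  have hsDC : ∀ t : ℂ, Complex.normSq t < R₁⁻¹ ^ 2 → s t ∈ DC := fun t ht =>
    ⟨by show r1 (s t) < R₁⁻¹ ^ 2; rw [hs, r1_sliceH]; exact ht, hsDH t⟩
  have hs00 : s 0 = 0 := by
    ext i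
    fin_cases i <;> simp [hs]
  have h0C : s 0 ∈ DC := hsDC 0 (by simpa using hR)
  have hinv1s : ∀ t, inv1 (s t) = s t⁻¹ := fun t => inv1_sliceH _ _ t
  -- `u = ηH ∘ s`
  have hu' : u = fun t => ηH (s t) := funext hu
  subst hu'
  -- (1) `u` is injective
  have h1 : Injective (fun t => ηH (s t)) := fun t t' h =>
    hs_inj (hHinj (hsDH t) (hsDH t') h)
  -- (2) `du_z` is injective
  have h2 : ∀ z, Injective (mfderiv 𝓘(ℝ, ℂ) (𝓡 4) (fun t => ηH (s t)) z) := fun z =>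
    mfderiv_comp_slice_injective (hs_fd z) hT_inj (hHloc ⟨s z, hsDH z⟩)
  -- (3) `dv_0` is injective: near `0`, `v = ηC ∘ s` by the gluing clause
  have hCt : ∀ t : ℂ, Complex.normSq t < R₁⁻¹ ^ 2 → t ≠ 0 → ηC (s t) = ηH (s t⁻¹) := by
    intro t ht ht0
    have h01 : s t 0 ≠ 0 ∨ s t 1 ≠ 0 := by
      rw [hs0, hs1]
      by_contra hc
      simp only [not_or, not_not] at hc
      exact ht0 (Complex.ext hc.1 hc.2)
    rw [hCH (s t) (hsDC t ht).1 (hsDC t ht).2 h01]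
    show ηH (inv1 (s t)) = ηH (s t⁻¹)
    rw [hinv1s]
  have hvE : v =ᶠ[𝓝 0] fun t => ηC (s t) := by
    filter_upwards [eventually_normSq_lt hR] with t ht
    by_cases ht0 : t = 0
    · subst ht0
      rw [hs00]
      exact hv0
    · rw [huv t ht0, hCt t ht ht0]
  have h3 : Injective (mfderiv 𝓘(ℝ, ℂ) (𝓡 4) v 0) := by
    rw [hvE.mfderiv_eq]
    exact mfderiv_comp_slice_injective (hs_fd 0) hT_inj (hCloc ⟨s 0, h0C⟩)
  -- (4) `v 0 = ηC 0 ∉ range u` by the axis clause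
  have h4 : v 0 ∉ Set.range (fun t => ηH (s t)) := by
    rintro ⟨z, hz⟩
    exact hHax (s z) (hs2 z) (hs3 z) (hz.trans hv0)
  exact ⟨h1, h2, h3, h4⟩

end Summit.SmoothPoincare4.SmoothPoincare4.Theorems.GromovRecognitionRelEnd.CrossCapLaurent

end
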